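import Literature.AlgebraicGeometry.ComplexMultiplication.SimpleCMAbelianVarietyIsogenyClasses
import Literature.NumberTheory.ComplexMultiplication.PrimitiveCMPairsClassificationComplex
import Literature.AlgebraicGeometry.Milne1999.CMSimpleIsogenousCMTyped
import HarnessLib

/-!
# Isogeny classes of simple complex abelian varieties of CM-type are the `Γ`-orbits of CM-types on `ℚ^{cm}`
# (Milne 1999, *Lefschetz motives and the Tate conjecture*, §2 Prop. 2.1 ∘ Prop. 2.2 = Prop. 2.3 for `K = ℚ^{cm}`)

Layer `Literature/AlgebraicGeometry/ComplexMultiplication` (lane `lit-hodgefound`; DAG-B node B5-05, last sentence).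
A JUNCTION file: the abelian-variety half (Prop. 2.1 = Milne, *Complex Multiplication*, Prop. 3.13, tree file
`SimpleCMAbelianVarietyIsogenyClasses`) is composed with the Galois half (Prop. 2.2 = Milne CM Cor. 1.31 in the
complex dictionary, tree file `NumberTheory/ComplexMultiplication/PrimitiveCMPairsClassificationComplex`) to give
PROP. 2.3 at `K = ℚ^{cm}` as a bijection of quotient sets.  Small definitions with bodies (the carrier
`SimpleCMAbelianVariety` of Milne's «simple abelian varieties over `ℂ` of CM-type» with its isogeny setoid, the
`Γ`-orbit `typeOrbit Φ` of a complex CM-pair, the map `SimpleCMAbelianVariety.psiOrbit` and its descent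
`psiOrbitClass`, the packaged `Equiv`); everything else is proved; no named fact.

THE PRINT.  J. S. Milne, *Lefschetz motives and the Tate conjecture*, Compositio Math. 117 (1999) 45–76
(held text `paper:doi-10-1023-a-1000776613765`; printed page = PDF page + 44), §2:

> (p. 54, L15–L16) A simple Abelian variety `A` over `C` is said to be of CM-type if `End⁰(A)` is a field
> (necessarily CM) of degree `2 dim A` over `ℚ` […]
> (p. 54, L22–L26) PROPOSITION 2.1. With the above notations, `φ` is a primitive CM-type on `E`, and the map
> `A ↦ (E, φ)` defines a bijection from the set of isogeny classes of simple Abelian varieties over `C` of CM-type to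
> the set of isomorphism classes of pairs `(E, φ)` consisting of a CM-field of finite degree over `ℚ` and a
> primitive CM-type on the field.
> (p. 54, L38–L42) Let `φ` be a CM-type on a CM-field `E`.  For each `τ : E → ℚ^{al}` and `σ ∈ Γ`, define
> `ψ_τ(σ) = φ(σ⁻¹ ∘ τ)`.  Then `ψ_τ` depends only on the restriction of `σ` to `ℚ^{cm}`, and `ψ_τ`, when regarded as
> a map `Hom(ℚ^{cm}, ℚ^{al}) → ℤ`, is a CM-type on `ℚ^{cm}`.  Moreover […] as `τ` runs over the embeddings
> `E ↪ ℚ^{al}`, `ψ_τ` runs over a `Γ`-orbit of CM-types on `ℚ^{cm}`.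
> (p. 55, L5–L7) PROPOSITION 2.2. The map `(E, φ) ↦ {ψ_τ}` defines a bijection from the set of isomorphism classes
> of pairs `(E, φ)` consisting of a CM-field of finite degree over `ℚ` and a primitive CM-type on the field to the set
> of `Γ`-orbits of CM-types on `ℚ^{cm}`.
> (p. 55, L19–L25) PROPOSITION 2.3. Let `K` be a CM-subfield of `C`. There is a natural one-to-one correspondence
> between the set of isogeny classes of simple Abelian varieties over `C` of CM-type whose reflex field is contained
> in `K` and the set of `Γ`-orbits of CM-types on `K`.  Proof. When `K = ℚ^{cm}`, this is an immediate consequence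
> of the preceding two propositions. […]

(`Γ = Gal(ℚ^{al}/ℚ)`, p. 54 L7; the reflex field of every CM-pair is contained in `ℚ^{cm}`, so at `K = ℚ^{cm}` the
condition «whose reflex field is contained in `K`» is empty.)

## Model (all carriers are the tree's, consumed by name)

* «simple abelian variety over `ℂ` of CM-type» — `A : Motives.AbelianVariety ℂ` with `A.IsSimple` and Milne's
  p. 54 clause verbatim `Milne1999.IsOfCMTypeSimple A` («`End⁰(A)` is a field of degree `2 dim A`»,
  `Milne1999/CMTypeSimpleIsogenyFactors`); the carrier `SimpleCMAbelianVariety` below; «isogeny classes» —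
  the quotient by `AbelianVariety.IsIsogenous` (an equivalence relation: `IsIsogenous.refl/symm'/trans`).
* «its associated CM-type `(E, φ)`» — a CM-typed realisation `IsCMTypeRealisation Φ B ι θ` (`K` a CM field,
  `Φ : Motives.CMType K`, Shimura's «`(B, ι)` of type `(K; Φ)`» read on `H¹`) of some `B ∼ A`; such a model exists
  UNCONDITIONALLY (`Milne1999.exists_isCMTyped_isIsogenous_of_isSimple`, Deligne 1982 Prop. 5.1 with Riemann's
  theorem `deligneMilne1982_Thm_6_20_full_holds`) and is unique up to Milne's isomorphism of CM-pairs
  (`exists_ringEquiv_forall_mem_iff_of_isIsogenous`, Prop. 3.13); Milne's `(E, φ)` is `(End⁰(A), Φ_A)`, which is this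
  pair up to the isomorphism `K ≅ End⁰(B)` (`ringHom_endAlgebra_bijective_of_isSimple`).
* «`Γ`-orbits of CM-types on `ℚ^{cm}`» — `MulAction.orbitRel.Quotient (Gal(ℚ^{cm}/ℚ)) CMNumbers.GalCMType`
  (`PrimitiveCMPairsClassification` §11: `ℚ^{cm} = NumberFields.cmNumbers`, CM-types on it `NumberFields.IsCMTypeOn`,
  and `Γ` acts through the SURJECTION `CMNumbers.galRestrict : Aut(ℂ) → Gal(ℚ^{cm}/ℚ)`, so `Γ`-orbits are
  `Gal(ℚ^{cm}/ℚ)`-orbits, `CMNumbers.range_galRestrict_smul`).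
* «`{ψ_τ}`» — the orbit of `psiType (cmValued Φ.1) (toCMNumbers φ₀)` (the complex dictionary of
  `PrimitiveCMPairsClassificationComplex`: `Hom(E, ℚ^{al}) = Hom(E, ℂ) ≃ Hom_ℚ(E, ℚ^{cm})` for `E` CM), the element
  `typeOrbit Φ` below.

## What is proved

* §1 `typeOrbit Φ` (the `Γ`-orbit `{ψ_τ}` of a complex CM-pair; `typeOrbit_eq_mk`: any base embedding `φ₀`;
  `typeOrbit_eq_typeOrbit_iff`: equality of `typeOrbit`s is equality of the set-level orbits of the tree's
  `cor_1_31_complex`), **well-definedness on isogeny classes** `typeOrbit_eq_of_isIsogenous` (Prop. 2.1's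
  «`A ↦ (E, φ)`» followed by Prop. 2.2's «`(E, φ) ↦ {ψ_τ}`»: CM-typed models of isogenous simple varieties have
  isomorphic pairs, `exists_ringEquiv_forall_mem_iff_of_isIsogenous`, hence `ψ`-types in one orbit,
  `isIsoCMPair_cmValued_iff` + `IsIsoCMPair.exists_psiType_eq_smul`), **injectivity** `isIsogenous_of_typeOrbit_eq`
  (simple ⟹ primitive, `isSimple_iff_isPrimitive`; Cor. 1.31 injectivity `exists_ringEquiv_iff_orbit_psiType_eq`;
  Prop. 3.13 converse `isIsogenous_of_ringEquiv_forall_mem_iff`) and **surjectivity**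
  `exists_isSimple_typeOrbit_eq_mk` (Cor. 1.31 surjectivity `exists_cmType_isPrimitive_psiType_eq` + a SIMPLE
  realisation of a primitive pair, `exists_isSimple_isCMTypeRealisation_of_isPrimitive`); the three clauses
  **`milne1999_prop_2_1_comp_2_2`**.
* §2 the carrier `SimpleCMAbelianVariety` (positive dimension, `IsOfCMType`, a CM-typed model
  `exists_isCMTypeRealisation_isIsogenous`), the map **`SimpleCMAbelianVariety.psiOrbit`** with its characterisation
  `psiOrbit_eq` (it is `typeOrbit Φ` for ANY CM-typed model `(K; Φ)` of any `B ∼ A`), isogeny invariance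
  `psiOrbit_eq_of_isIsogenous`, and the descent **`psiOrbitClass`** to isogeny classes.
* §3 **PROPOSITION 2.3 for `K = ℚ^{cm}`**: `isIsogenous_iff_psiOrbit_eq`, `psiOrbitClass_injective`,
  `psiOrbitClass_surjective`, **`milne1999_prop_2_3_cmNumbers : Function.Bijective psiOrbitClass`** and the packaged
  **`isogenyClassesEquivGalOrbits : Quotient SimpleCMAbelianVariety.isogenySetoid ≃ orbitRel.Quotient Gal(ℚ^{cm}/ℚ) CMNumbers.GalCMType`**;
  validation: neither side is empty (`CMNumbers.nonempty_galCMType`, `SimpleCMAbelianVariety.nonempty`).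

NOT here (FILE 2 of the row): the level-`K` statement of Prop. 2.3 («whose reflex field is contained in `K`» ↔
`Γ`-orbits of CM-types on a CM field `K` Galois over `ℚ`), which passes through `NumberFields.extendType`.

## References

* [Milne1999] J. S. Milne, *Lefschetz motives and the Tate conjecture*, Compositio Math. 117 (1999) 45–76, §2
  pp. 54–55: definition of CM-type, Prop. 2.1, Prop. 2.2, Prop. 2.3.
* [MilneCM2006] J. S. Milne, *Complex Multiplication* (course notes; v0.10, 2020), Ch. I §1 Cor. 1.31 (p. 19),
  §3 Prop. 3.13 (p. 30) — through the two tree files named above.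
* [Deligne1982HodgeCycles] P. Deligne, *Hodge cycles on abelian varieties*, LNM 900 (1982), I Prop. 5.1, §5 p. 37 —
  through `Milne1999.exists_isCMTyped_isIsogenous_of_isSimple`.
* [Shimura1998] G. Shimura, *Abelian Varieties with Complex Multiplication and Modular Functions* (1998), §8.2
  Prop. 26, §6.1 Cor. of Thm. 2 — through `isSimple_iff_isPrimitive`, `isIsogenous_of_ringEquiv_forall_mem_iff`.
-/

noncomputable section

open CategoryTheory NumberField
open scoped Pointwise

namespace Literature.AlgebraicGeometry.ComplexMultiplication

open Literature.AlgebraicGeometry.Motives (CMType AbelianVariety)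
open Literature.AlgebraicGeometry.Motives.AbelianVariety
open Literature.AlgebraicGeometry.HodgeTheory (complexBetti)
open Literature.AlgebraicGeometry.Milne1999 (IsOfCMType IsOfCMTypeSimple IsCMTyped
  exists_isCMTyped_isIsogenous_of_isSimple)
open Literature.NumberTheory.ComplexMultiplication
open Literature.NumberTheory.ComplexMultiplication.CMNumbers
open Literature.NumberTheory.NumberFields (cmNumbers cmNumbersConj IsCMTypeOn)

/-! ## §1 The `Γ`-orbit `{ψ_τ}` of a complex CM-pair and of a CM-typed abelian variety -/

section TypeOrbit

variable {K : Type} [Field K] [NumberField K] [IsCMField K]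
  {K' : Type} [Field K'] [NumberField K'] [IsCMField K']

/-- The `ψ`-type `ψ_{φ₀} ⊆ Gal(ℚ^{cm}/ℚ)` of the complex CM-pair `(K; Φ)` at the embedding `φ₀ : K → ℂ`, as a CM-type on
`ℚ^{cm}` («`ψ_τ`, when regarded as a map `Hom(ℚ^{cm}, ℚ^{al}) → ℤ`, is a CM-type on `ℚ^{cm}`»; the tree's
`isCMTypeOn_psiType_cmValued`). [cite: Milne1999, §2 p. 54 L38–L40] -/
def psiGalCMType (Φ : CMType K) (φ₀ : K →+* ℂ) : CMNumbers.GalCMType :=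
  ⟨psiType (cmValued Φ.1) (toCMNumbers φ₀), isCMTypeOn_psiType_cmValued Φ φ₀⟩

/-- Unfolding `psiGalCMType`. [cite: Milne1999, §2 p. 54 L38–L40] -/
@[simp] theorem coe_psiGalCMType (Φ : CMType K) (φ₀ : K →+* ℂ) :
    (psiGalCMType Φ φ₀).1 = psiType (cmValued Φ.1) (toCMNumbers φ₀) :=
  rfl

/-- `ψ_{g ∘ φ₀} = (g|_{ℚ^{cm}}) ψ_{φ₀}` («`ψ_{ρ∘τ}(σ) = ψ_τ(ρ⁻¹ ∘ σ) = (ρψ_τ)(σ)`»). [cite: Milne1999, §2 p. 54 L41] -/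
theorem psiGalCMType_smul (Φ : CMType K) (g : ℂ ≃+* ℂ) (φ₀ : K →+* ℂ) :
    psiGalCMType Φ (g • φ₀) = galRestrict g • psiGalCMType Φ φ₀ :=
  Subtype.ext (by rw [CMNumbers.GalCMType.coe_smul, coe_psiGalCMType, coe_psiGalCMType, toCMNumbers_smul, psiType_smul])

/-- «as `τ` runs over the embeddings, `ψ_τ` runs over a `Γ`-orbit»: the `ψ`-types of one pair at two base embeddings
are `Gal(ℚ^{cm}/ℚ)`-translates of each other (`Gal(ℚ^{cm}/ℚ)` is transitive on `Hom_ℚ(K, ℚ^{cm})`, `ℚ^{cm}/ℚ` being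
normal). [cite: Milne1999, §2 p. 54 L41–L42] -/
theorem exists_smul_psiGalCMType_eq (Φ : CMType K) (φ₀ φ₀' : K →+* ℂ) :
    ∃ τ : cmNumbers ≃ₐ[ℚ] cmNumbers, τ • psiGalCMType Φ φ₀ = psiGalCMType Φ φ₀' := by
  obtain ⟨τ, hτ⟩ := exists_algEquiv_smul_eq (toCMNumbers φ₀) (toCMNumbers φ₀')
  exact ⟨τ, Subtype.ext (by
    rw [CMNumbers.GalCMType.coe_smul, coe_psiGalCMType, coe_psiGalCMType, ← hτ, psiType_smul])⟩

/-- **The `Γ`-orbit `{ψ_τ}` of the complex CM-pair `(K; Φ)`**, an element of the orbit set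
`{CM-types on ℚ^{cm}}/Gal(ℚ^{cm}/ℚ)` (computed at an arbitrary base embedding; independent of it by `typeOrbit_eq_mk`).
[cite: Milne1999, §2 p. 54 L41–L42 and Prop. 2.2 (p. 55)] -/
def typeOrbit (Φ : CMType K) : MulAction.orbitRel.Quotient (cmNumbers ≃ₐ[ℚ] cmNumbers) CMNumbers.GalCMType :=
  Quotient.mk _ (psiGalCMType Φ (Classical.arbitrary (K →+* ℂ)))

/-- `typeOrbit Φ` is the class of `ψ_{φ₀}` for EVERY `φ₀ : K → ℂ`. [cite: Milne1999, §2 p. 54 L41–L42] -/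
theorem typeOrbit_eq_mk (Φ : CMType K) (φ₀ : K →+* ℂ) :
    typeOrbit Φ = Quotient.mk (MulAction.orbitRel (cmNumbers ≃ₐ[ℚ] cmNumbers) CMNumbers.GalCMType)
      (psiGalCMType Φ φ₀) := by
  obtain ⟨τ, hτ⟩ := exists_smul_psiGalCMType_eq Φ φ₀ (Classical.arbitrary (K →+* ℂ))
  rw [typeOrbit, ← hτ]
  exact Quotient.sound (MulAction.orbitRel_apply.mpr (MulAction.mem_orbit _ _))

/-- Two complex CM-pairs have the same `Γ`-orbit iff the set-level orbits of their `ψ`-types (the form used in the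
tree's `CMNumbers.cor_1_31_complex`) coincide, at any base embeddings. [cite: Milne1999, §2 Prop. 2.2 (p. 55)] -/
theorem typeOrbit_eq_typeOrbit_iff (Φ : CMType K) (Φ' : CMType K') (φ₀ : K →+* ℂ) (φ₀' : K' →+* ℂ) :
    typeOrbit Φ = typeOrbit Φ' ↔
      MulAction.orbit (cmNumbers ≃ₐ[ℚ] cmNumbers) (psiType (cmValued Φ.1) (toCMNumbers φ₀)) =
        MulAction.orbit (cmNumbers ≃ₐ[ℚ] cmNumbers) (psiType (cmValued Φ'.1) (toCMNumbers φ₀')) := by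
  rw [typeOrbit_eq_mk Φ φ₀, typeOrbit_eq_mk Φ' φ₀', MulAction.orbit_eq_iff]
  constructor
  · intro h
    obtain ⟨τ, hτ⟩ := MulAction.orbitRel_apply.mp (Quotient.exact h)
    exact ⟨τ, by simpa using congrArg Subtype.val hτ⟩
  · rintro ⟨τ, hτ⟩
    exact Quotient.sound (MulAction.orbitRel_apply.mpr ⟨τ, Subtype.ext (by simpa using hτ)⟩)

/-- `typeOrbit Φ = typeOrbit Φ'` iff `ψ_{φ₀'}' = τ ψ_{φ₀}` for some `τ ∈ Gal(ℚ^{cm}/ℚ)`. [cite: Milne1999, §2 Prop. 2.2 (p. 55)] -/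
theorem typeOrbit_eq_typeOrbit_iff_exists_smul (Φ : CMType K) (Φ' : CMType K') (φ₀ : K →+* ℂ) (φ₀' : K' →+* ℂ) :
    typeOrbit Φ = typeOrbit Φ' ↔ ∃ τ : cmNumbers ≃ₐ[ℚ] cmNumbers,
      psiType (cmValued Φ'.1) (toCMNumbers φ₀') = τ • psiType (cmValued Φ.1) (toCMNumbers φ₀) := by
  rw [typeOrbit_eq_typeOrbit_iff Φ Φ' φ₀ φ₀', eq_comm, MulAction.orbit_eq_iff, MulAction.mem_orbit_iff]
  exact exists_congr fun τ ↦ eq_comm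

/-! ### Well-definedness: Prop. 2.1's `A ↦ (E, φ)` followed by Prop. 2.2's `(E, φ) ↦ {ψ_τ}` -/

/-- **Isomorphic complex CM-pairs have the same `Γ`-orbit** (Prop. 2.2, well-definedness: Milne's isomorphism of
CM-pairs `e : K ≃ K'`, `u ∈ Φ' ↔ u ∘ e ∈ Φ`, read in `ℚ^{cm}` by `isIsoCMPair_cmValued_iff`, then
`IsIsoCMPair.exists_psiType_eq_smul`). [cite: Milne1999, §2 Prop. 2.2 (p. 55)] -/
theorem typeOrbit_eq_of_ringEquiv {Φ : CMType K} {Φ' : CMType K'} (e : K ≃+* K')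
    (he : ∀ u : K' →+* ℂ, u ∈ Φ'.1 ↔ u.comp e.toRingHom ∈ Φ.1) : typeOrbit Φ = typeOrbit Φ' := by
  obtain ⟨φ₀⟩ := (inferInstance : Nonempty (K →+* ℂ))
  obtain ⟨φ₀'⟩ := (inferInstance : Nonempty (K' →+* ℂ))
  have hiso : IsIsoCMPair (cmValued Φ.1) (cmValued Φ'.1) := (isIsoCMPair_cmValued_iff Φ.1 Φ'.1).mpr ⟨e, he⟩
  exact (typeOrbit_eq_typeOrbit_iff_exists_smul Φ Φ' φ₀ φ₀').mpr
    (hiso.exists_psiType_eq_smul (toCMNumbers φ₀) (toCMNumbers φ₀'))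

variable {B B' : AbelianVariety ℂ} {Φ : CMType K} {Φ' : CMType K'}
  {ι : 𝓞 K →+* End B} {θ : K →+* Module.End ℂ (complexBetti B.X 1)}
  {ι' : 𝓞 K' →+* End B'} {θ' : K' →+* Module.End ℂ (complexBetti B'.X 1)}

/-- **Well-definedness on isogeny classes** («the map `A ↦ (E, φ)` defines a bijection from the set of isogeny
classes …» composed with Prop. 2.2): CM-typed models `(B, ι, θ)` of `(K; Φ)` and `(B', ι', θ')` of `(K'; Φ')` of two
ISOGENOUS abelian varieties, `B` simple, have the same `Γ`-orbit `{ψ_τ}` (the pairs are isomorphic, Milne CM Prop. 3.13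
= tree `exists_ringEquiv_forall_mem_iff_of_isIsogenous`). [cite: Milne1999, §2 Prop. 2.1 and Prop. 2.3 proof (pp. 54–55)] -/
theorem typeOrbit_eq_of_isIsogenous (hB : IsCMTypeRealisation Φ B ι θ) (hB' : IsCMTypeRealisation Φ' B' ι' θ')
    (hs : B.IsSimple) (h : IsIsogenous B B') : typeOrbit Φ = typeOrbit Φ' := by
  obtain ⟨e, he⟩ := exists_ringEquiv_forall_mem_iff_of_isIsogenous hB hB' hs h
  exact typeOrbit_eq_of_ringEquiv e he

/-! ### Injectivity: Prop. 2.2 on primitive pairs, and Prop. 2.1's converse -/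

omit [IsCMField K] in
/-- «`φ` is a primitive CM-type on `E`»: the type of a CM-typed model of a SIMPLE abelian variety is primitive at every
base embedding (Shimura §8.2 Prop. 26 = tree `isSimple_iff_isPrimitive`). [cite: Milne1999, §2 Prop. 2.1 (p. 54)] -/
theorem isPrimitive_of_isSimple (hB : IsCMTypeRealisation Φ B ι θ) (hs : B.IsSimple) (φ₀ : K →+* ℂ) :
    IsPrimitive (ℂ ≃+* ℂ) Φ.1 φ₀ :=
  (isSimple_iff_isPrimitive hB φ₀).mp hs

/-- **Injectivity**: CM-typed models of two SIMPLE abelian varieties with the same `Γ`-orbit `{ψ_τ}` are isogenous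
(both types are primitive; equal orbits give isomorphic pairs, Cor. 1.31 = tree `exists_ringEquiv_iff_orbit_psiType_eq`;
isomorphic pairs have isogenous realisations, Shimura §6.1 Cor. = tree `isIsogenous_of_ringEquiv_forall_mem_iff`).
[cite: Milne1999, §2 Prop. 2.1, Prop. 2.2 and Prop. 2.3 proof (pp. 54–55)] -/
theorem isIsogenous_of_typeOrbit_eq (hB : IsCMTypeRealisation Φ B ι θ) (hB' : IsCMTypeRealisation Φ' B' ι' θ')
    (hs : B.IsSimple) (hs' : B'.IsSimple) (h : typeOrbit Φ = typeOrbit Φ') : IsIsogenous B B' := by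
  obtain ⟨φ₀⟩ := (inferInstance : Nonempty (K →+* ℂ))
  obtain ⟨φ₀'⟩ := (inferInstance : Nonempty (K' →+* ℂ))
  obtain ⟨e, he⟩ := (exists_ringEquiv_iff_orbit_psiType_eq (isPrimitive_of_isSimple hB hs φ₀)
    (isPrimitive_of_isSimple hB' hs' φ₀')).mpr ((typeOrbit_eq_typeOrbit_iff Φ Φ' φ₀ φ₀').mp h)
  exact isIsogenous_of_ringEquiv_forall_mem_iff e he hB hB'

/-- **Prop. 2.1 ∘ Prop. 2.2 on models**: for CM-typed models of two SIMPLE abelian varieties, `B ∼ B'` iff the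
`Γ`-orbits `{ψ_τ}` coincide. [cite: Milne1999, §2 Prop. 2.3 proof (p. 55)] -/
theorem isIsogenous_iff_typeOrbit_eq (hB : IsCMTypeRealisation Φ B ι θ) (hB' : IsCMTypeRealisation Φ' B' ι' θ')
    (hs : B.IsSimple) (hs' : B'.IsSimple) : IsIsogenous B B' ↔ typeOrbit Φ = typeOrbit Φ' :=
  ⟨typeOrbit_eq_of_isIsogenous hB hB' hs, isIsogenous_of_typeOrbit_eq hB hB' hs hs'⟩

end TypeOrbit

/-! ### Surjectivity: every `Γ`-orbit of CM-types on `ℚ^{cm}` comes from a simple CM abelian variety -/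

/-- **Surjectivity**: every CM-type `Ψ` on `ℚ^{cm}` is, up to `Γ`, the `ψ`-type of a SIMPLE complex abelian variety with
a CM-typed structure — `Ψ = ψ_{φ₀}` for a primitive complex CM-pair `(E ⊆ ℚ^{cm}, Φ)` (Cor. 1.31, tree
`exists_cmType_isPrimitive_psiType_eq`), which is the type of a simple abelian variety (Prop. 2.1 / Shimura §6.2
Thm. 3 + §8.2 Prop. 26, tree `exists_isSimple_isCMTypeRealisation_of_isPrimitive`).
[cite: Milne1999, §2 Prop. 2.1, Prop. 2.2 (pp. 54–55)] -/
theorem exists_isSimple_typeOrbit_eq_mk (Ψ : CMNumbers.GalCMType) :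
    ∃ (E : IntermediateField ℚ cmNumbers) (_ : NumberField E) (_ : IsCMField E) (Φ : CMType E)
      (B : AbelianVariety ℂ) (ι : 𝓞 E →+* End B) (θ : E →+* Module.End ℂ (complexBetti B.X 1)),
      IsCMTypeRealisation Φ B ι θ ∧ B.IsSimple ∧ 2 * B.dim = Module.finrank ℚ E ∧
        typeOrbit Φ = Quotient.mk (MulAction.orbitRel (cmNumbers ≃ₐ[ℚ] cmNumbers) CMNumbers.GalCMType) Ψ := by
  obtain ⟨E, hE, hCM, Φ, hP, hψ⟩ := exists_cmType_isPrimitive_psiType_eq Ψ.2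
  obtain ⟨B, ι, θ, hB, hs, hdim⟩ := exists_isSimple_isCMTypeRealisation_of_isPrimitive Φ _ hP
  refine ⟨E, hE, hCM, Φ, B, ι, θ, hB, hs, hdim, ?_⟩
  rw [typeOrbit_eq_mk Φ ((algebraMap cmNumbers ℂ).comp (algebraMap E cmNumbers))]
  exact congrArg _ (Subtype.ext hψ)

/-- **Milne 1999 Prop. 2.1 ∘ Prop. 2.2, on CM-typed models, in three clauses**: the map «CM-typed simple abelian
variety ↦ `Γ • ψ_τ`» (1) is constant on isogeny classes, (2) separates non-isogenous simple varieties, (3) hits every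
`Γ`-orbit of CM-types on `ℚ^{cm}`. [cite: Milne1999, §2 Prop. 2.1, Prop. 2.2, Prop. 2.3 (pp. 54–55)] -/
theorem milne1999_prop_2_1_comp_2_2 :
    (∀ {K : Type} [Field K] [NumberField K] [IsCMField K] {K' : Type} [Field K'] [NumberField K'] [IsCMField K']
        {Φ : CMType K} {Φ' : CMType K'} {B B' : AbelianVariety ℂ}
        {ι : 𝓞 K →+* End B} {θ : K →+* Module.End ℂ (complexBetti B.X 1)}
        {ι' : 𝓞 K' →+* End B'} {θ' : K' →+* Module.End ℂ (complexBetti B'.X 1)},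
        IsCMTypeRealisation Φ B ι θ → IsCMTypeRealisation Φ' B' ι' θ' → B.IsSimple → B'.IsSimple →
          (IsIsogenous B B' ↔ typeOrbit Φ = typeOrbit Φ')) ∧
      (∀ Ψ : CMNumbers.GalCMType,
        ∃ (E : IntermediateField ℚ cmNumbers) (_ : NumberField E) (_ : IsCMField E) (Φ : CMType E)
          (B : AbelianVariety ℂ) (ι : 𝓞 E →+* End B) (θ : E →+* Module.End ℂ (complexBetti B.X 1)),
          IsCMTypeRealisation Φ B ι θ ∧ B.IsSimple ∧ 2 * B.dim = Module.finrank ℚ E ∧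
            typeOrbit Φ = Quotient.mk (MulAction.orbitRel (cmNumbers ≃ₐ[ℚ] cmNumbers) CMNumbers.GalCMType) Ψ) :=
  ⟨fun hB hB' hs hs' ↦ isIsogenous_iff_typeOrbit_eq hB hB' hs hs', exists_isSimple_typeOrbit_eq_mk⟩

/-! ## §2 Simple complex abelian varieties of CM-type and the map `A ↦ {ψ_τ}` -/

/-- **The simple abelian varieties over `ℂ` of CM-type** (Milne 1999 p. 54: `A` simple and «`End⁰(A)` is a field
(necessarily CM) of degree `2 dim A` over `ℚ`», the tree's `Milne1999.IsOfCMTypeSimple`).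
[cite: Milne1999, §2 p. 54 L15–L16] -/
def SimpleCMAbelianVariety : Type 1 :=
  {A : AbelianVariety ℂ // A.IsSimple ∧ IsOfCMTypeSimple A}

namespace SimpleCMAbelianVariety

/-- **Isogeny** as a `Setoid` on the simple abelian varieties of CM-type («the set of isogeny classes»).
[cite: Milne1999, §2 Prop. 2.1 (p. 54)] -/
instance isogenySetoid : Setoid SimpleCMAbelianVariety where
  r A A' := IsIsogenous A.1 A'.1
  iseqv := ⟨fun A ↦ IsIsogenous.refl A.1, fun h ↦ h.symm', fun h h' ↦ h.trans h'⟩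

/-- Unfolding the isogeny relation. [cite: Milne1999, §2 Prop. 2.1 (p. 54)] -/
theorem equiv_iff (A A' : SimpleCMAbelianVariety) : A ≈ A' ↔ IsIsogenous A.1 A'.1 :=
  Iff.rfl

variable (A : SimpleCMAbelianVariety)

/-- [cite: Milne1999, §2 p. 54 L15–L16] -/
theorem isSimple : A.1.IsSimple :=
  A.2.1

/-- [cite: Milne1999, §2 p. 54 L15–L16] -/
theorem isOfCMTypeSimple : IsOfCMTypeSimple A.1 :=
  A.2.2

/-- Milne's clause implies the étale form `IsOfCMType` (the binder of the tree's `HC_CM`; tree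
`IsOfCMTypeSimple.isOfCMType`). [cite: Milne1999, §2 p. 54] -/
theorem isOfCMType : IsOfCMType A.1 :=
  A.2.2.isOfCMType

/-- A simple abelian variety of CM-type has positive dimension (`End⁰(A)` is a field, so `End⁰(A) ≠ 0`, so `A ≠ 0`).
[cite: Milne1999, §2 p. 54 L15–L16] -/
theorem dim_pos : 0 < A.1.dim := by
  by_contra h0
  have hA : A.1.dim = 0 := Nat.eq_zero_of_not_pos h0
  obtain ⟨x, y, hxy⟩ := A.2.2.1.exists_pair_ne
  have h1 : (1 : A.1.endAlgebra) = 0 := by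
    rw [← map_one (AbelianVariety.endAlgebra.of A.1), ← map_zero (AbelianVariety.endAlgebra.of A.1)]
    congr 1
    exact AbelianVariety.hom_eq_zero_of_dim_eq_zero (Or.inl hA) _
  haveI : Subsingleton A.1.endAlgebra := subsingleton_of_zero_eq_one h1.symm
  exact hxy (Subsingleton.elim x y)

/-- **A CM-typed model in the isogeny class** («let `E = End⁰(A)` … define `φ(τ)` … according as `i ∘ τ` does, or
does not, occur in the representation of `E` on the tangent space»; on the tree's carriers: `A` is isogenous to an
abelian variety `B` carrying a realisation `(B, ι, θ)` of a CM type `(K; Φ)` of a CM field read on `H¹` — Deligne 1982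
Prop. 5.1 with Riemann's theorem, tree `Milne1999.exists_isCMTyped_isIsogenous_of_isSimple`).
[cite: Milne1999, §2 p. 54 L18–L21] [cite: Deligne1982HodgeCycles, I Prop. 5.1 and §5 (p. 37)] -/
theorem exists_isCMTypeRealisation_isIsogenous :
    ∃ (K : Type) (_ : Field K) (_ : NumberField K) (_ : IsCMField K) (Φ : CMType K) (B : AbelianVariety ℂ)
      (ι : 𝓞 K →+* End B) (θ : K →+* Module.End ℂ (complexBetti B.X 1)),
      IsCMTypeRealisation Φ B ι θ ∧ IsIsogenous A.1 B := by
  obtain ⟨B, hB, hAB⟩ := exists_isCMTyped_isIsogenous_of_isSimple A.1 A.isSimple A.dim_pos A.isOfCMType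
  obtain ⟨Φ, B, ι, θ, h⟩ := hB
  rename_i K _ _ _
  exact ⟨K, inferInstance, inferInstance, inferInstance, Φ, B, ι, θ, h, hAB⟩

/-- The `Γ`-orbit attached to `A` is well defined: there is exactly one orbit `o` with `typeOrbit Φ = o` for every
CM-typed model `(K; Φ)` of every `B ∼ A`. [cite: Milne1999, §2 Prop. 2.1 and Prop. 2.3 proof (pp. 54–55)] -/
theorem existsUnique_typeOrbit :
    ∃! o : MulAction.orbitRel.Quotient (cmNumbers ≃ₐ[ℚ] cmNumbers) CMNumbers.GalCMType,
      ∀ {K : Type} [Field K] [NumberField K] [IsCMField K] (Φ : CMType K) (B : AbelianVariety ℂ)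
        (ι : 𝓞 K →+* End B) (θ : K →+* Module.End ℂ (complexBetti B.X 1)),
        IsCMTypeRealisation Φ B ι θ → IsIsogenous A.1 B → typeOrbit Φ = o := by
  obtain ⟨K₀, _, _, _, Φ₀, B₀, ι₀, θ₀, hB₀, hAB₀⟩ := A.exists_isCMTypeRealisation_isIsogenous
  refine ⟨typeOrbit Φ₀, fun Φ B ι θ hB hAB ↦ ?_, fun o ho ↦ (ho Φ₀ B₀ ι₀ θ₀ hB₀ hAB₀).symm⟩
  exact typeOrbit_eq_of_isIsogenous hB hB₀ (A.isSimple.of_isIsogenous hAB) (hAB.symm'.trans hAB₀)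

/-- **The map `A ↦ {ψ_τ}`** from simple complex abelian varieties of CM-type to `Γ`-orbits of CM-types on `ℚ^{cm}`
(through any CM-typed model of the isogeny class, `psiOrbit_eq`). [cite: Milne1999, §2 Prop. 2.1–2.3 (pp. 54–55)] -/
def psiOrbit : MulAction.orbitRel.Quotient (cmNumbers ≃ₐ[ℚ] cmNumbers) CMNumbers.GalCMType :=
  A.existsUnique_typeOrbit.exists.choose

variable {A}
variable {K : Type} [Field K] [NumberField K] [IsCMField K] {Φ : CMType K} {B : AbelianVariety ℂ}
  {ι : 𝓞 K →+* End B} {θ : K →+* Module.End ℂ (complexBetti B.X 1)}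

/-- **`psiOrbit` computed on any model**: if `(B, ι, θ)` realises `(K; Φ)` and `B ∼ A`, then `A.psiOrbit = typeOrbit Φ`.
[cite: Milne1999, §2 Prop. 2.1–2.3 (pp. 54–55)] -/
theorem psiOrbit_eq (hB : IsCMTypeRealisation Φ B ι θ) (hAB : IsIsogenous A.1 B) : A.psiOrbit = typeOrbit Φ :=
  (A.existsUnique_typeOrbit.exists.choose_spec Φ B ι θ hB hAB).symm

/-- `psiOrbit` at the base embedding `φ₀` of a model: the class of `ψ_{φ₀}`. [cite: Milne1999, §2 p. 54 L38–L42] -/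
theorem psiOrbit_eq_mk (hB : IsCMTypeRealisation Φ B ι θ) (hAB : IsIsogenous A.1 B) (φ₀ : K →+* ℂ) :
    A.psiOrbit = Quotient.mk (MulAction.orbitRel (cmNumbers ≃ₐ[ℚ] cmNumbers) CMNumbers.GalCMType)
      (psiGalCMType Φ φ₀) := by
  rw [psiOrbit_eq hB hAB, typeOrbit_eq_mk Φ φ₀]

/-- **`psiOrbit` is an isogeny invariant.** [cite: Milne1999, §2 Prop. 2.1 and Prop. 2.3 (pp. 54–55)] -/
theorem psiOrbit_eq_of_isIsogenous {A A' : SimpleCMAbelianVariety} (h : IsIsogenous A.1 A'.1) :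
    A.psiOrbit = A'.psiOrbit := by
  obtain ⟨K, _, _, _, Φ, B, ι, θ, hB, hAB⟩ := A'.exists_isCMTypeRealisation_isIsogenous
  rw [psiOrbit_eq hB hAB, psiOrbit_eq hB (h.trans hAB)]

/-- **The map of Proposition 2.3 (`K = ℚ^{cm}`)** on isogeny classes: `[A] ↦ {ψ_τ}`.
[cite: Milne1999, §2 Prop. 2.3 (p. 55)] -/
def psiOrbitClass :
    Quotient isogenySetoid → MulAction.orbitRel.Quotient (cmNumbers ≃ₐ[ℚ] cmNumbers) CMNumbers.GalCMType :=
  Quotient.lift psiOrbit fun _ _ h ↦ psiOrbit_eq_of_isIsogenous h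

/-- `psiOrbitClass [A] = A.psiOrbit`. [cite: Milne1999, §2 Prop. 2.3 (p. 55)] -/
@[simp] theorem psiOrbitClass_mk (A : SimpleCMAbelianVariety) :
    psiOrbitClass (Quotient.mk isogenySetoid A) = A.psiOrbit :=
  rfl

/-! ## §3 Proposition 2.3 for `K = ℚ^{cm}`: the bijection -/

/-- **Injectivity**: simple CM abelian varieties with the same `Γ`-orbit are isogenous.
[cite: Milne1999, §2 Prop. 2.3 (p. 55)] -/
theorem isIsogenous_of_psiOrbit_eq {A A' : SimpleCMAbelianVariety} (h : A.psiOrbit = A'.psiOrbit) :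
    IsIsogenous A.1 A'.1 := by
  obtain ⟨K, _, _, _, Φ, B, ι, θ, hB, hAB⟩ := A.exists_isCMTypeRealisation_isIsogenous
  obtain ⟨K', _, _, _, Φ', B', ι', θ', hB', hAB'⟩ := A'.exists_isCMTypeRealisation_isIsogenous
  rw [psiOrbit_eq hB hAB, psiOrbit_eq hB' hAB'] at h
  exact (hAB.trans (isIsogenous_of_typeOrbit_eq hB hB' (A.isSimple.of_isIsogenous hAB)
    (A'.isSimple.of_isIsogenous hAB') h)).trans hAB'.symm'

/-- **`A ∼ A'` iff `{ψ_τ}(A) = {ψ_τ}(A')`.** [cite: Milne1999, §2 Prop. 2.3 (p. 55)] -/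
theorem isIsogenous_iff_psiOrbit_eq (A A' : SimpleCMAbelianVariety) :
    IsIsogenous A.1 A'.1 ↔ A.psiOrbit = A'.psiOrbit :=
  ⟨psiOrbit_eq_of_isIsogenous, isIsogenous_of_psiOrbit_eq⟩

/-- [cite: Milne1999, §2 Prop. 2.3 (p. 55)] -/
theorem psiOrbitClass_injective : Function.Injective psiOrbitClass := by
  intro a b
  induction a using Quotient.inductionOn with | h A => ?_
  induction b using Quotient.inductionOn with | h A' => ?_
  intro h
  exact Quotient.sound (isIsogenous_of_psiOrbit_eq h)

/-- **Surjectivity**: every `Γ`-orbit of CM-types on `ℚ^{cm}` is `{ψ_τ}(B)` for a simple complex abelian variety `B` of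
CM-type (a simple realisation of a primitive pair with the prescribed `ψ`, `exists_isSimple_typeOrbit_eq_mk`; a CM-typed
abelian variety satisfies Milne's clause, `isOfCMType_of_isCMTypeRealisation` + `IsOfCMType.isOfCMTypeSimple`).
[cite: Milne1999, §2 Prop. 2.3 (p. 55)] -/
theorem psiOrbitClass_surjective : Function.Surjective psiOrbitClass := by
  intro c
  induction c using Quotient.inductionOn with | h Ψ => ?_
  obtain ⟨E, _, _, Φ, B, ι, θ, hB, hs, -, h⟩ := exists_isSimple_typeOrbit_eq_mk Ψ
  refine ⟨Quotient.mk isogenySetoid ⟨B, hs, (isOfCMType_of_isCMTypeRealisation hB).isOfCMTypeSimple hs hB.dim_pos⟩, ?_⟩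
  rw [psiOrbitClass_mk, psiOrbit_eq hB (IsIsogenous.refl B), h]

/-- **PROPOSITION 2.3 for `K = ℚ^{cm}`** (Milne 1999 §2; «an immediate consequence of the preceding two propositions»):
`[A] ↦ {ψ_τ}` is a BIJECTION from the isogeny classes of simple abelian varieties over `ℂ` of CM-type onto the
`Γ`-orbits of CM-types on `ℚ^{cm}`. [cite: Milne1999, §2 Prop. 2.3 (p. 55)] -/
theorem milne1999_prop_2_3_cmNumbers : Function.Bijective psiOrbitClass :=
  ⟨psiOrbitClass_injective, psiOrbitClass_surjective⟩

/-- **PROPOSITION 2.3 for `K = ℚ^{cm}`, packaged**: the natural one-to-one correspondence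
`{simple complex abelian varieties of CM-type}/isogeny ≃ {CM-types on ℚ^{cm}}/Γ`. [cite: Milne1999, §2 Prop. 2.3 (p. 55)] -/
def isogenyClassesEquivGalOrbits :
    Quotient isogenySetoid ≃ MulAction.orbitRel.Quotient (cmNumbers ≃ₐ[ℚ] cmNumbers) CMNumbers.GalCMType :=
  Equiv.ofBijective psiOrbitClass milne1999_prop_2_3_cmNumbers

/-- [cite: Milne1999, §2 Prop. 2.3 (p. 55)] -/
@[simp] theorem isogenyClassesEquivGalOrbits_apply (a : Quotient isogenySetoid) :
    isogenyClassesEquivGalOrbits a = psiOrbitClass a :=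
  rfl

/-! ### Validation: neither side of the correspondence is empty -/

/-- There are simple complex abelian varieties of CM-type (realise the primitive pair behind any CM-type on `ℚ^{cm}`,
e.g. the one behind `{σ | σ(i) = i}`, `CMNumbers.nonempty_galCMType`). [cite: Milne1999, §2 Prop. 2.1 (p. 54)] -/
instance nonempty : Nonempty SimpleCMAbelianVariety := by
  obtain ⟨Ψ⟩ := CMNumbers.nonempty_galCMType
  obtain ⟨a, -⟩ := psiOrbitClass_surjective (Quotient.mk _ Ψ)
  induction a using Quotient.inductionOn with | h A => ?_
  exact ⟨A⟩

/-- … and isogeny classes of them. [cite: Milne1999, §2 Prop. 2.1 (p. 54)] -/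
instance nonempty_quotient : Nonempty (Quotient isogenySetoid) :=
  ⟨Quotient.mk _ (Classical.arbitrary SimpleCMAbelianVariety)⟩

end SimpleCMAbelianVariety

end Literature.AlgebraicGeometry.ComplexMultiplication

end
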